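import Summits.QuantumFields.YangMills.Theorems.BalabanUVNodesN19ChebyshevArcFunctional
import Literature.Probability.FitznerVanDerHofstad2017.NbwChebyshevBound

/-!
# YM-DAG node N19 (= NE7 proper) — THE COMPLEMENTARY CHEBYSHEV-ARC LAWS (part 2): the `1`-Lipschitz test polynomial `(T_{n−1} − T_{n+1})∕(4n)` is
# paid EXACTLY `1∕(2n)`; the laws `P_n, Q_n` on the even ∕ odd arcs — one base for all levels, mgfs `2l₀^{n−1}∕(n−1)!`-close to it

Cell `pub-ymgap`, HUMAN RULING D-0062 (Track A) ∕ D-0149 (work-bound push), R141 (C) wider-strategy seat `pub-ymgap-dag-n19-e` (strategy s3 =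
ALTERNATIVE CURRENCY), generation g21, module 9 (lineage module 72; part 1 = module 71 `…N19ChebyshevArcFunctional`).  Route
`Summits/QuantumFields/YangMills/Theses/BalabanUVNodes.lean` rev 25, cluster item K3⁷ «SpineGivenEndpointR13SepCoPH» (stmt-QuantumFields-20544); filed
`--supports` that item `--as helper` (it proves no registered stub).  COUNT-NEUTRAL: [folklore] real analysis over Mathlib (Chebyshev `T`, `U`: `T_real_cos`,
`T_derivative_eq_U`, `two_mul_T_eq_U_sub_U`, `U_eq_X_mul_U_add_T`, `T_eq_U_sub_X_mul_U`, `abs_eval_T_real_le_one`, the extremal `node`s), the tree's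
`Literature.Probability.FitznerVanDerHofstad2017.abs_eval_U_le` (`NbwChebyshevBound`) (`|U_m| ≤ m + 1` on `[−1,1]`, BY IMPORT) + part 1 BY NAME; no scheme
object, no Theses import; NOT a discharge claim.

§3 THE TEST POLYNOMIAL `g_n = (T_{n−1} − T_{n+1})∕(4n)` (`= sin nθ·sin θ∕(2n)` at `x = cos θ`; `n ≥ 3`).  `|U_m(x)| ≤ m + 1` on `[−1,1]`
(the tree's Fitzner–van der Hofstad Chebyshev bound); `g_n′ = ((n−1)U_{n−2} − (n+1)U_n)∕(4n) = −(nT_n + xU_{n−1})∕(2n)`, so `|g_n′| ≤ 1` and `g_n` is `1`-Lipschitz on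
`[−1,1]` (mean value inequality) with `|g_n| ≤ 1∕(2n)`; its antiderivative `G_n = (2T_n∕n − T_{n−2}∕(n−2) − T_{n+2}∕(n+2))∕(8n)` (`2T_{m+2} = U_{m+2} − U_m`)
has `(−1)^k G_n(x_k) = (2∕n − (1∕(n−2) + 1∕(n+2)) cos(2kπ∕n))∕(8n)` at the extrema, whence by part 1's half-end sum (`a = 2`)
★★ `alt_sum_integral_testPoly`: `Σ_{k<n} (−1)^k ∫_{x_{k+1}}^{x_k} g_n = 1∕(2n)` EXACTLY.
§4 ★★ `exists_chebyshevArc_laws`: for `n ≥ 3` with `2l₀ ≤ n` there are probability laws `P, Q` on `[−1,1]` (Lebesgue on the even ∕ odd arcs) such that for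
`|t| ≤ l₀` BOTH `|mgf P t − ½∫_{−1}^{1} e^{tx}dx|` and `|mgf Q t − ½∫_{−1}^{1} e^{tx}dx|` are `≤ 2l₀^{n−1}∕(n−1)!` (ONE base — the uniform law — for EVERY
level), and `∫g_n dP − ∫g_n dQ = 1∕(2n)` for the `1`-Lipschitz, `[−½,½]`-valued `g_n`.  Module 73 runs the levels into one sequence.

HONEST FRAMING (binding).  Elementary and [folklore] (Chebyshev ∕ Favard perfect-spline extremal); toy laws, no scheme object; NO consumer in the DAG today;
nothing of Bałaban's instantiated; NE7 NOT PRINTED, NOT proved; N19 NOT discharged; count-neutral.  One finite `T⁴` programme at fixed `ε`; nothing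
continuum ∕ `ℝ⁴` ∕ OS ∕ mass-gap ∕ Clay.  0 `def` ∕ 0 `sorry`.
-/

noncomputable section

open Real Finset MeasureTheory ProbabilityTheory Polynomial Polynomial.Chebyshev

namespace Summit.QuantumFields.YangMills.Theorems.BalabanUVNodesN19ChebyshevArcLaws

open Summit.QuantumFields.YangMills.Theorems.BalabanUVNodesN19ChebyshevArcFunctional
open Literature.Probability.FitznerVanDerHofstad2017 (abs_eval_U_le)

/-! ## §3 The test polynomial `(T_{n−1} − T_{n+1})∕(4n)`: `1`-Lipschitz on `[−1,1]`, paid exactly `1∕(2n)` [folklore] -/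

/-- The derivative identity `(n+1)U_n(x) − (n−1)U_{n−2}(x) = 2nT_n(x) + 2xU_{n−1}(x)` (evaluated; `U_n = xU_{n−1} + T_n`, `U_{n−2} = xU_{n−1} − T_n`). [folklore] -/
theorem eval_U_combination (n : ℕ) (x : ℝ) :
    ((n : ℝ) + 1) * (U ℝ (n : ℤ)).eval x - ((n : ℝ) - 1) * (U ℝ ((n : ℤ) - 2)).eval x =
      2 * n * (T ℝ (n : ℤ)).eval x + 2 * x * (U ℝ ((n : ℤ) - 1)).eval x := by
  have h1 := congrArg (Polynomial.eval x) (U_eq_X_mul_U_add_T ℝ ((n : ℤ) - 1))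
  have h2 := congrArg (Polynomial.eval x) (U_sub_one ℝ ((n : ℤ) - 1))
  simp only [sub_add_cancel, eval_add, eval_mul, eval_X, eval_sub, eval_ofNat, show ((n : ℤ) - 1 - 1) = (n : ℤ) - 2 by ring] at h1 h2
  have h3 := congrArg (Polynomial.eval x) (T_eq_U_sub_X_mul_U ℝ (n : ℤ))
  simp only [eval_sub, eval_mul, eval_X] at h3
  -- `U_n = x U_{n-1} + T_n`, `U_{n-2} = 2x U_{n-1} − U_n`
  rw [h2, h1]
  ring

/-- The test polynomial is `1`-Lipschitz and `1∕(2n)`-bounded on `[−1,1]` (`n ≥ 1`). [folklore] -/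
theorem testPoly_lipschitz_bound {n : ℕ} (hn : 1 ≤ n) :
    (∀ x y : ℝ, x ∈ Set.Icc (-1 : ℝ) 1 → y ∈ Set.Icc (-1 : ℝ) 1 →
      |((T ℝ ((n : ℤ) - 1)).eval x - (T ℝ ((n : ℤ) + 1)).eval x) / (4 * n) -
        ((T ℝ ((n : ℤ) - 1)).eval y - (T ℝ ((n : ℤ) + 1)).eval y) / (4 * n)| ≤ 1 * |x - y|) ∧
    ∀ x : ℝ, x ∈ Set.Icc (-1 : ℝ) 1 → |((T ℝ ((n : ℤ) - 1)).eval x - (T ℝ ((n : ℤ) + 1)).eval x) / (4 * n)| ≤ 1 / (2 * n) := by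
  have hnr : (0 : ℝ) < n := by exact_mod_cast hn
  refine ⟨fun x y hx hy => ?_, fun x hx => ?_⟩
  · -- mean value inequality with `|g′| ≤ 1`
    have hderiv : ∀ z : ℝ, HasDerivAt (fun z => ((T ℝ ((n : ℤ) - 1)).eval z - (T ℝ ((n : ℤ) + 1)).eval z) / (4 * n))
        ((((n : ℝ) - 1) * (U ℝ ((n : ℤ) - 2)).eval z - ((n : ℝ) + 1) * (U ℝ (n : ℤ)).eval z) / (4 * n)) z := by
      intro z
      have h1 := (T ℝ ((n : ℤ) - 1)).hasDerivAt z
      have h2 := (T ℝ ((n : ℤ) + 1)).hasDerivAt z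
      rw [T_derivative_eq_U, eval_mul] at h1 h2
      have e1 : ((((n : ℤ) - 1 : ℤ) : ℝ[X])).eval z = (n : ℝ) - 1 := by simp
      have e2 : ((((n : ℤ) + 1 : ℤ) : ℝ[X])).eval z = (n : ℝ) + 1 := by simp
      rw [e1, show ((n : ℤ) - 1 - 1) = (n : ℤ) - 2 by ring] at h1
      rw [e2, show ((n : ℤ) + 1 - 1) = (n : ℤ) by ring] at h2
      exact (h1.sub h2).div_const _
    have hbound : ∀ z ∈ Set.Icc (-1 : ℝ) 1,
        ‖deriv (fun z => ((T ℝ ((n : ℤ) - 1)).eval z - (T ℝ ((n : ℤ) + 1)).eval z) / (4 * n)) z‖ ≤ 1 := by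
      intro z hz
      rw [(hderiv z).deriv, Real.norm_eq_abs]
      have hid := eval_U_combination n z
      have hT : |(T ℝ (n : ℤ)).eval z| ≤ 1 := abs_eval_T_real_le_one _ (abs_le.2 ⟨hz.1, hz.2⟩)
      have hU : |(U ℝ ((n : ℤ) - 1)).eval z| ≤ n := by
        rcases Nat.exists_eq_add_of_le hn with ⟨m, rfl⟩
        have h := abs_eval_U_le m (abs_le.2 ⟨hz.1, hz.2⟩)
        push_cast at h ⊢
        rw [show (1 + (m : ℤ) - 1) = (m : ℤ) by ring]
        linarith
      have hz1 : |z| ≤ 1 := abs_le.2 ⟨hz.1, hz.2⟩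
      rw [abs_div, abs_of_pos (by positivity : (0 : ℝ) < 4 * n), div_le_one (by positivity)]
      have e : ((n : ℝ) - 1) * (U ℝ ((n : ℤ) - 2)).eval z - ((n : ℝ) + 1) * (U ℝ (n : ℤ)).eval z =
          -(2 * n * (T ℝ (n : ℤ)).eval z + 2 * z * (U ℝ ((n : ℤ) - 1)).eval z) := by linarith [hid]
      rw [e, abs_neg]
      calc |2 * n * (T ℝ (n : ℤ)).eval z + 2 * z * (U ℝ ((n : ℤ) - 1)).eval z|
          ≤ |2 * n * (T ℝ (n : ℤ)).eval z| + |2 * z * (U ℝ ((n : ℤ) - 1)).eval z| := abs_add_le _ _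
        _ ≤ 2 * n * 1 + 2 * 1 * n := by
            rw [abs_mul, abs_mul, abs_mul, abs_mul, abs_of_pos (by norm_num : (0 : ℝ) < 2), abs_of_pos hnr]
            exact add_le_add (mul_le_mul_of_nonneg_left hT (by positivity))
              (mul_le_mul (mul_le_mul_of_nonneg_left hz1 two_pos.le) hU (abs_nonneg _) (by positivity))
        _ = 4 * n := by ring
    have h := (convex_Icc (-1 : ℝ) 1).norm_image_sub_le_of_norm_deriv_le (fun z _ => (hderiv z).differentiableAt) hbound hy hx
    simpa only [Real.norm_eq_abs] using h
  · have h1 : |(T ℝ ((n : ℤ) - 1)).eval x| ≤ 1 := abs_eval_T_real_le_one _ (abs_le.2 ⟨hx.1, hx.2⟩)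
    have h2 : |(T ℝ ((n : ℤ) + 1)).eval x| ≤ 1 := abs_eval_T_real_le_one _ (abs_le.2 ⟨hx.1, hx.2⟩)
    rw [abs_div, abs_of_pos (by positivity : (0 : ℝ) < 4 * n), div_le_div_iff₀ (by positivity) (by positivity)]
    have := abs_sub _ _ |>.trans (add_le_add h1 h2)
    nlinarith [abs_nonneg ((T ℝ ((n : ℤ) - 1)).eval x - (T ℝ ((n : ℤ) + 1)).eval x)]

/-- The antiderivative `G_n = (2T_n∕n − T_{n−2}∕(n−2) − T_{n+2}∕(n+2))∕(8n)` of the test polynomial (`2T_{m+2} = U_{m+2} − U_m`; `n ≥ 3`). [folklore] -/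
theorem hasDerivAt_testPolyPrim {n : ℕ} (hn : 3 ≤ n) (x : ℝ) :
    HasDerivAt (fun x => (2 * (T ℝ (n : ℤ)).eval x / n - (T ℝ ((n : ℤ) - 2)).eval x / ((n : ℝ) - 2) -
        (T ℝ ((n : ℤ) + 2)).eval x / ((n : ℝ) + 2)) / (8 * n))
      (((T ℝ ((n : ℤ) - 1)).eval x - (T ℝ ((n : ℤ) + 1)).eval x) / (4 * n)) x := by
  have hnr : (3 : ℝ) ≤ n := by exact_mod_cast hn
  have hn0 : (n : ℝ) ≠ 0 := by linarith
  have hn2 : (n : ℝ) - 2 ≠ 0 := by linarith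
  have hn2' : (n : ℝ) + 2 ≠ 0 := by linarith
  -- derivatives of the three Chebyshev polynomials
  have hd : ∀ m : ℤ, HasDerivAt (fun x => (T ℝ m).eval x) ((m : ℝ) * (U ℝ (m - 1)).eval x) x := fun m => by
    have h := (T ℝ m).hasDerivAt x
    rw [T_derivative_eq_U, eval_mul] at h
    have e : ((m : ℝ[X])).eval x = (m : ℝ) := by simp
    rwa [e] at h
  have h0 := hd (n : ℤ)
  have h1 := hd ((n : ℤ) - 2)
  have h2 := hd ((n : ℤ) + 2)
  have hG : HasDerivAt (fun x => (2 * (T ℝ (n : ℤ)).eval x / n - (T ℝ ((n : ℤ) - 2)).eval x / ((n : ℝ) - 2) -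
        (T ℝ ((n : ℤ) + 2)).eval x / ((n : ℝ) + 2)) / (8 * n))
      ((2 * ((((n : ℤ) : ℤ) : ℝ) * (U ℝ ((n : ℤ) - 1)).eval x) / n -
        ((((n : ℤ) - 2 : ℤ) : ℝ) * (U ℝ ((n : ℤ) - 2 - 1)).eval x) / ((n : ℝ) - 2) -
        ((((n : ℤ) + 2 : ℤ) : ℝ) * (U ℝ ((n : ℤ) + 2 - 1)).eval x) / ((n : ℝ) + 2)) / (8 * n)) x :=
    ((((h0.const_mul 2).div_const _).sub (h1.div_const _)).sub (h2.div_const _)).div_const _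
  refine hG.congr_deriv ?_
  -- identify the derivative with the test polynomial: `2U_{n−1} − U_{n−3} − U_{n+1} = 2T_{n−1} − 2T_{n+1}`
  have i1 := congrArg (Polynomial.eval x) (two_mul_T_eq_U_sub_U ℝ ((n : ℤ) - 3))
  have i2 := congrArg (Polynomial.eval x) (two_mul_T_eq_U_sub_U ℝ ((n : ℤ) - 1))
  simp only [eval_mul, eval_ofNat, eval_sub, show (n : ℤ) - 3 + 2 = (n : ℤ) - 1 by ring, show (n : ℤ) - 1 + 2 = (n : ℤ) + 1 by ring] at i1 i2
  rw [show ((n : ℤ) - 2 - 1) = (n : ℤ) - 3 by ring, show ((n : ℤ) + 2 - 1) = (n : ℤ) + 1 by ring]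
  push_cast
  field_simp
  linear_combination (-4 : ℝ) * i1 + 4 * i2

/-- Node values: `(−1)^k·T_n(x_k) = 1`, `(−1)^k·T_{n±2}(x_k) = cos(2kπ∕n)` at the extrema `x_k = cos(kπ∕n)`, `k ≤ n`. [bookkeeping] -/
theorem negOnePow_mul_eval_T_node {n k : ℕ} (hn : n ≠ 0) (hk : k ≤ n) :
    (-1 : ℝ) ^ k * (T ℝ (n : ℤ)).eval (node n k) = 1 ∧
      (-1 : ℝ) ^ k * (T ℝ ((n : ℤ) + 2)).eval (node n k) = Real.cos (2 * k * π / n) ∧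
      (-1 : ℝ) ^ k * (T ℝ ((n : ℤ) - 2)).eval (node n k) = Real.cos (2 * k * π / n) := by
  have hnr : (n : ℝ) ≠ 0 := Nat.cast_ne_zero.2 hn
  refine ⟨?_, ?_, ?_⟩
  · rw [eval_T_real_node (Finset.mem_Iic.2 hk), ← mul_pow]; norm_num
  · rw [node, T_real_cos]
    have h := negOnePow_mul_cos_node ((n : ℤ) + 2) n k hn
    push_cast at h ⊢
    rw [show (((n : ℝ) + 2) * (k * π / n)) = ((n : ℝ) + 2) * k * π / n by ring, h]
    rw [show (((n : ℝ) + 2 + n) * k * π / n) = 2 * k * π / n + k * (2 * π) by field_simp; ring, Real.cos_add_nat_mul_two_pi]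
  · rw [node, T_real_cos]
    have h := negOnePow_mul_cos_node ((n : ℤ) - 2) n k hn
    push_cast at h ⊢
    rw [show (((n : ℝ) - 2) * (k * π / n)) = ((n : ℝ) - 2) * k * π / n by ring, h]
    rw [show (((n : ℝ) - 2 + n) * k * π / n) = k * (2 * π) - 2 * k * π / n by field_simp; ring, Real.cos_nat_mul_two_pi_sub]

/-- **★★ THE TEST POLYNOMIAL IS PAID EXACTLY `1∕(2n)`** by the alternating arc functional (`n ≥ 3`): the fundamental theorem of calculus with `G_n`,
the node values `(−1)^kG_n(x_k) = (2∕n − (1∕(n−2) + 1∕(n+2))cos(2kπ∕n))∕(8n)`, and part 1's half-end sum at `a = 2`. [folklore] -/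
theorem alt_sum_integral_testPoly {n : ℕ} (hn : 3 ≤ n) :
    ∑ k ∈ range n, (-1 : ℝ) ^ k * ∫ x in node n (k + 1)..node n k,
      ((T ℝ ((n : ℤ) - 1)).eval x - (T ℝ ((n : ℤ) + 1)).eval x) / (4 * n) = 1 / (2 * n) := by
  have hn0 : n ≠ 0 := by omega
  have hnr : (3 : ℝ) ≤ n := by exact_mod_cast hn
  set G : ℝ → ℝ := fun x => (2 * (T ℝ (n : ℤ)).eval x / n - (T ℝ ((n : ℤ) - 2)).eval x / ((n : ℝ) - 2) -
      (T ℝ ((n : ℤ) + 2)).eval x / ((n : ℝ) + 2)) / (8 * n) with hGdef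
  have hcont : Continuous fun x : ℝ => ((T ℝ ((n : ℤ) - 1)).eval x - (T ℝ ((n : ℤ) + 1)).eval x) / (4 * n) :=
    ((Polynomial.continuous _).sub (Polynomial.continuous _)).div_const _
  have hFTC : ∀ k : ℕ, ∫ x in node n (k + 1)..node n k, ((T ℝ ((n : ℤ) - 1)).eval x - (T ℝ ((n : ℤ) + 1)).eval x) / (4 * n) =
      G (node n k) - G (node n (k + 1)) := fun k =>
    intervalIntegral.integral_eq_sub_of_hasDerivAt (fun x _ => hasDerivAt_testPolyPrim hn x) (hcont.intervalIntegrable _ _)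
  simp_rw [hFTC]
  -- node values of `(−1)^k G`
  set c : ℝ := 1 / ((n : ℝ) - 2) + 1 / ((n : ℝ) + 2) with hc
  have hu : ∀ k : ℕ, k ≤ n → (-1 : ℝ) ^ k * G (node n k) = (2 / n - c * Real.cos (2 * k * π / n)) / (8 * n) := by
    intro k hk
    obtain ⟨e0, e2, e2'⟩ := negOnePow_mul_eval_T_node hn0 hk
    simp only [hGdef, hc]
    have : (-1 : ℝ) ^ k * ((2 * (T ℝ (n : ℤ)).eval (node n k) / n - (T ℝ ((n : ℤ) - 2)).eval (node n k) / ((n : ℝ) - 2) -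
        (T ℝ ((n : ℤ) + 2)).eval (node n k) / ((n : ℝ) + 2)) / (8 * n)) =
        (2 * ((-1 : ℝ) ^ k * (T ℝ (n : ℤ)).eval (node n k)) / n - ((-1 : ℝ) ^ k * (T ℝ ((n : ℤ) - 2)).eval (node n k)) / ((n : ℝ) - 2) -
          ((-1 : ℝ) ^ k * (T ℝ ((n : ℤ) + 2)).eval (node n k)) / ((n : ℝ) + 2)) / (8 * n) := by ring
    rw [this, e0, e2, e2']
    ring
  -- rewrite the alternating sum as `Σ_k (u_k + u_{k+1})`
  have hterm : ∀ k ∈ range n, (-1 : ℝ) ^ k * (G (node n k) - G (node n (k + 1))) =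
      (2 / n - c * Real.cos (2 * k * π / n)) / (8 * n) + (2 / n - c * Real.cos (2 * (k + 1 : ℕ) * π / n)) / (8 * n) := by
    intro k hk
    have hkn : k < n := Finset.mem_range.1 hk
    rw [mul_sub, hu k hkn.le, ← hu (k + 1) hkn, pow_succ]
    ring
  rw [Finset.sum_congr rfl hterm, Finset.sum_add_distrib]
  have hcos := sum_cos_halfEnds_eq_zero hn0 (a := 2) (by
    intro hd
    obtain ⟨c', hc'⟩ := hd
    push_cast at hc'
    have h3 : (3 : ℤ) ≤ n := by exact_mod_cast hn
    rcases le_or_gt c' 0 with h | h <;> nlinarith)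
  push_cast at hcos
  have e1 : ∑ k ∈ range n, (2 / n - c * Real.cos (2 * k * π / n)) / (8 * n) =
      n * ((2 / n) / (8 * n)) - c / (8 * n) * ∑ k ∈ range n, Real.cos (2 * k * π / n) := by
    simp_rw [sub_div]
    rw [Finset.sum_sub_distrib, Finset.sum_const, Finset.card_range, nsmul_eq_mul, Finset.mul_sum]
    congr 1
    exact Finset.sum_congr rfl fun k _ => by ring
  have e2 : ∑ k ∈ range n, (2 / n - c * Real.cos (2 * ((k + 1 : ℕ) : ℝ) * π / n)) / (8 * n) =
      n * ((2 / n) / (8 * n)) - c / (8 * n) * ∑ k ∈ range n, Real.cos (2 * ((k : ℝ) + 1) * π / n) := by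
    simp_rw [sub_div]
    rw [Finset.sum_sub_distrib, Finset.sum_const, Finset.card_range, nsmul_eq_mul, Finset.mul_sum]
    congr 1
    exact Finset.sum_congr rfl fun k _ => by push_cast; ring
  rw [e1, e2]
  have hsum : ∑ k ∈ range n, Real.cos (2 * k * π / n) + ∑ k ∈ range n, Real.cos (2 * ((k : ℝ) + 1) * π / n) = 0 := hcos
  have hn0r : (n : ℝ) ≠ 0 := by linarith
  calc n * ((2 / n) / (8 * n)) - c / (8 * n) * ∑ k ∈ range n, Real.cos (2 * k * π / n) +
        (n * ((2 / n) / (8 * n)) - c / (8 * n) * ∑ k ∈ range n, Real.cos (2 * ((k : ℝ) + 1) * π / n))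
      = 2 * (n * ((2 / n) / (8 * n))) - c / (8 * n) *
          (∑ k ∈ range n, Real.cos (2 * k * π / n) + ∑ k ∈ range n, Real.cos (2 * ((k : ℝ) + 1) * π / n)) := by ring
    _ = 1 / (2 * n) := by rw [hsum, mul_zero, sub_zero]; field_simp; ring

/-! ## §4 The laws on the even ∕ odd arcs [folklore] -/

/-- The Lebesgue measure of a family of arcs: total mass. [bookkeeping] -/
theorem arcMeasure_apply_univ (n : ℕ) {s : Finset ℕ} (hs : s ⊆ range n) :
    (∑ k ∈ s, (volume : Measure ℝ).restrict (Set.Ioc (node n (k + 1)) (node n k))) Set.univ =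
      ENNReal.ofReal (∑ k ∈ s, (node n k - node n (k + 1))) := by
  rw [Measure.finsetSum_apply, ENNReal.ofReal_sum_of_nonneg fun k hk =>
    sub_nonneg.2 (node_succ_lt (Finset.mem_range.1 (hs hk))).le]
  exact Finset.sum_congr rfl fun k _ => by rw [Measure.restrict_apply_univ, Real.volume_Ioc]

/-- The Lebesgue measure of a family of arcs is carried by `[−1,1]`. [bookkeeping] -/
theorem arcMeasure_Icc_compl (n : ℕ) (s : Finset ℕ) :
    (∑ k ∈ s, (volume : Measure ℝ).restrict (Set.Ioc (node n (k + 1)) (node n k))) (Set.Icc (-1 : ℝ) 1)ᶜ = 0 := by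
  rw [Measure.finsetSum_apply]
  refine Finset.sum_eq_zero fun k _ => ?_
  rw [Measure.restrict_apply measurableSet_Icc.compl]
  have hsub : Set.Ioc (node n (k + 1)) (node n k) ⊆ Set.Icc (-1 : ℝ) 1 := fun x hx =>
    ⟨(node_mem_Icc (n := n) (i := k + 1)).1.trans hx.1.le, hx.2.trans (node_mem_Icc (n := n) (i := k)).2⟩
  refine measure_mono_null (Set.inter_subset_inter_right _ hsub) ?_
  rw [Set.compl_inter_self]
  exact measure_empty

/-- Integration against the Lebesgue measure of a family of arcs = the sum of the arc integrals (continuous `f`). [bookkeeping] -/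
theorem integral_arcMeasure (n : ℕ) {s : Finset ℕ} (hs : s ⊆ range n) {f : ℝ → ℝ} (hf : Continuous f) :
    ∫ x, f x ∂(∑ k ∈ s, (volume : Measure ℝ).restrict (Set.Ioc (node n (k + 1)) (node n k))) =
      ∑ k ∈ s, ∫ x in node n (k + 1)..node n k, f x := by
  rw [integral_finsetSum_measure fun k _ => (hf.integrableOn_Icc.mono_set Set.Ioc_subset_Icc_self)]
  exact Finset.sum_congr rfl fun k hk => (intervalIntegral.integral_of_le (node_succ_lt (Finset.mem_range.1 (hs hk))).le).symm

/-- Even ∕ odd splitting of an alternating sum. [bookkeeping] -/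
theorem alt_sum_eq_even_sub_odd (n : ℕ) (a : ℕ → ℝ) :
    ∑ k ∈ range n, (-1 : ℝ) ^ k * a k = ∑ k ∈ (range n).filter (fun k => Even k), a k - ∑ k ∈ (range n).filter (fun k => ¬ Even k), a k := by
  rw [← Finset.sum_filter_add_sum_filter_not (range n) (fun k => Even k), sub_eq_add_neg, ← Finset.sum_neg_distrib]
  congr 1
  · exact Finset.sum_congr rfl fun k hk => by rw [(Finset.mem_filter.1 hk).2.neg_one_pow, one_mul]
  · exact Finset.sum_congr rfl fun k hk => by rw [(Nat.not_even_iff_odd.1 (Finset.mem_filter.1 hk).2).neg_one_pow]; ring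

/-- The arcs tile `(−1, 1]`: `Σ_{k<n} ∫_{x_{k+1}}^{x_k} f = ∫_{−1}^{1} f` (`n ≥ 1`, `f` continuous). [bookkeeping] -/
theorem sum_integral_arcs {n : ℕ} (hn : n ≠ 0) {f : ℝ → ℝ} (hf : Continuous f) :
    ∑ k ∈ range n, ∫ x in node n (k + 1)..node n k, f x = ∫ x in (-1 : ℝ)..1, f x := by
  have h := intervalIntegral.sum_integral_adjacent_intervals (a := fun k => node n k) (n := n) (f := f) (μ := volume)
    fun k _ => hf.intervalIntegrable _ _
  rw [node_eq_one, node_eq_neg_one hn] at h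
  rw [← neg_inj, ← Finset.sum_neg_distrib, ← intervalIntegral.integral_symm, ← h]
  exact Finset.sum_congr rfl fun k _ => (intervalIntegral.integral_symm _ _).symm

/-- **★★ THE COMPLEMENTARY CHEBYSHEV-ARC LAWS.**  For `n ≥ 3` there are probability laws `P, Q` on `[−1,1]` (Lebesgue measure on the even ∕ odd arcs between
the Chebyshev extrema `cos(kπ∕n)`) such that: (i) for every window with `2l₀ ≤ n` and `|t| ≤ l₀`, BOTH mgfs are within `2l₀^{n−1}∕(n−1)!` of the base
`½∫_{−1}^{1}e^{tx}dx` (the mgf of the uniform law — ONE base for EVERY level); (ii) a continuous `g`, `1`-Lipschitz and `1∕(2n)`-bounded on `[−1,1]`,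
is paid `∫g dP − ∫g dQ = 1∕(2n)` EXACTLY. [folklore] -/
theorem exists_chebyshevArc_laws {n : ℕ} (hn : 3 ≤ n) :
    ∃ P Q : Measure ℝ, IsProbabilityMeasure P ∧ IsProbabilityMeasure Q ∧
      P (Set.Icc (-1 : ℝ) 1)ᶜ = 0 ∧ Q (Set.Icc (-1 : ℝ) 1)ᶜ = 0 ∧
      (∀ l₀ t : ℝ, 2 * l₀ ≤ n → |t| ≤ l₀ →
        |mgf id P t - (1 / 2) * ∫ x in (-1 : ℝ)..1, Real.exp (t * x)| ≤ 2 * (l₀ ^ (n - 1) / ((n - 1).factorial : ℝ)) ∧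
        |mgf id Q t - (1 / 2) * ∫ x in (-1 : ℝ)..1, Real.exp (t * x)| ≤ 2 * (l₀ ^ (n - 1) / ((n - 1).factorial : ℝ))) ∧
      ∃ g : ℝ → ℝ, Continuous g ∧
        (∀ x y : ℝ, x ∈ Set.Icc (-1 : ℝ) 1 → y ∈ Set.Icc (-1 : ℝ) 1 → |g x - g y| ≤ 1 * |x - y|) ∧
        (∀ x : ℝ, x ∈ Set.Icc (-1 : ℝ) 1 → |g x| ≤ 1 / (2 * n)) ∧
        ∫ x, g x ∂P - ∫ x, g x ∂Q = 1 / (2 * n) := by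
  have hn0 : n ≠ 0 := by omega
  have hE : (range n).filter (fun k => Even k) ⊆ range n := Finset.filter_subset _ _
  have hO : (range n).filter (fun k => ¬ Even k) ⊆ range n := Finset.filter_subset _ _
  set P : Measure ℝ := ∑ k ∈ (range n).filter (fun k => Even k), (volume : Measure ℝ).restrict (Set.Ioc (node n (k + 1)) (node n k)) with hP
  set Q : Measure ℝ := ∑ k ∈ (range n).filter (fun k => ¬ Even k), (volume : Measure ℝ).restrict (Set.Ioc (node n (k + 1)) (node n k)) with hQ
  obtain ⟨hEsum, hOsum⟩ := sum_arcLength_even_odd (n := n) (by omega)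
  have iP : IsProbabilityMeasure P := ⟨by rw [hP, arcMeasure_apply_univ n hE, hEsum, ENNReal.ofReal_one]⟩
  have iQ : IsProbabilityMeasure Q := ⟨by rw [hQ, arcMeasure_apply_univ n hO, hOsum, ENNReal.ofReal_one]⟩
  -- the two structural identities: `∫dP − ∫dQ = Σ(−1)^k∫_k`, `∫dP + ∫dQ = ∫_{−1}^{1}`
  have hsub : ∀ {f : ℝ → ℝ}, Continuous f → ∫ x, f x ∂P - ∫ x, f x ∂Q = ∑ k ∈ range n, (-1 : ℝ) ^ k * ∫ x in node n (k + 1)..node n k, f x :=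
    fun hf => by rw [hP, hQ, integral_arcMeasure n hE hf, integral_arcMeasure n hO hf, alt_sum_eq_even_sub_odd]
  have hadd : ∀ {f : ℝ → ℝ}, Continuous f → ∫ x, f x ∂P + ∫ x, f x ∂Q = ∫ x in (-1 : ℝ)..1, f x := fun hf => by
    rw [hP, hQ, integral_arcMeasure n hE hf, integral_arcMeasure n hO hf, Finset.sum_filter_add_sum_filter_not, sum_integral_arcs hn0 hf]
  refine ⟨P, Q, iP, iQ, by rw [hP]; exact arcMeasure_Icc_compl n _, by rw [hQ]; exact arcMeasure_Icc_compl n _, fun l₀ t hl ht => ?_,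
    fun x => ((T ℝ ((n : ℤ) - 1)).eval x - (T ℝ ((n : ℤ) + 1)).eval x) / (4 * n),
    ((Polynomial.continuous _).sub (Polynomial.continuous _)).div_const _,
    (testPoly_lipschitz_bound (by omega)).1, (testPoly_lipschitz_bound (by omega)).2, ?_⟩
  · -- the mgfs against the base
    have hc : Continuous fun x : ℝ => Real.exp (t * x) := Real.continuous_exp.comp (continuous_const.mul continuous_id)
    have hmP : mgf id P t = ∫ x, Real.exp (t * x) ∂P := by simp only [mgf, id]
    have hmQ : mgf id Q t = ∫ x, Real.exp (t * x) ∂Q := by simp only [mgf, id]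
    have h1 := hsub hc
    have h2 := hadd hc
    have hA := abs_alt_sum_integral_exp_le (n := n) (by omega) hl ht
    rw [← h1] at hA
    rw [hmP, hmQ]
    constructor
    · have e : ∫ x, Real.exp (t * x) ∂P - 1 / 2 * ∫ x in (-1 : ℝ)..1, Real.exp (t * x) =
          (1 / 2) * (∫ x, Real.exp (t * x) ∂P - ∫ x, Real.exp (t * x) ∂Q) := by rw [← h2]; ring
      rw [e, abs_mul, abs_of_pos (by norm_num : (0 : ℝ) < 1 / 2)]
      linarith
    · have e : ∫ x, Real.exp (t * x) ∂Q - 1 / 2 * ∫ x in (-1 : ℝ)..1, Real.exp (t * x) =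
          -((1 / 2) * (∫ x, Real.exp (t * x) ∂P - ∫ x, Real.exp (t * x) ∂Q)) := by rw [← h2]; ring
      rw [e, abs_neg, abs_mul, abs_of_pos (by norm_num : (0 : ℝ) < 1 / 2)]
      linarith
  · -- the payment
    rw [hsub (f := fun x => ((T ℝ ((n : ℤ) - 1)).eval x - (T ℝ ((n : ℤ) + 1)).eval x) / (4 * n))
      (by exact ((Polynomial.continuous _).sub (Polynomial.continuous _)).div_const _)]
    exact alt_sum_integral_testPoly hn

end Summit.QuantumFields.YangMills.Theorems.BalabanUVNodesN19ChebyshevArcLaws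

end
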